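import Mathlib
import Summits.NavierStokesRegularity.NavierStokesRegularity.Theorems.TaoLadderRungTwoFlatAheadTail
import Summits.NavierStokesRegularity.NavierStokesRegularity.Theorems.TaoLadderRungTwoFlatBootstrap
import Summits.NavierStokesRegularity.NavierStokesRegularity.Theorems.TaoLadderRungTwoFlatCoMovingEnergyCalculus
import Summits.NavierStokesRegularity.NavierStokesRegularity.Theorems.TaoLadderRungTwoFlatGaugeGronwallOn
import HarnessLib

/-!
# AHEAD-TAIL-62, analytic half: the TAIL-ENERGY INDUCTION proving the per-cut step `HopTube.AheadCutStepTarget`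
  (theory-1 g48 numT62 62.13, the ONE analytic statement behind the tail input (T1) of the core contract and behind the
  AHEAD zone one shell up; helper for the K_A♭ parent item stmt-NavierStokesRegularity-22987 `FlatGapCertificatesV2`,
  route TaoLadderRungTwoFlat; cell harvest/h2-tao-ladder, p1 g24; LADDER §62)

`HopTube.AheadCutStepTarget P Bcl 𝕊 ε₀ i₀ α X₀ w r c₀ ζ u⋆ ε n j V G` (…AheadTail, a design `Prop`): a boundary bond bound
`|S₁(j,·)| ≤ V` on `[0, c₀]`, the initial tail energy `Σ_{m>j} Σᵢ S₀(i,m)² ≤ G²` (all finite partial sums) and the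
closing inequality `(4/3)·c₀·clock_j·V·(V + 2εG) < G` give the cut envelope `|Sᵢ(m,t)| ≤ 2G` (`m > j`, `t ∈ [0, c₀]`)
for every premise flow of hop `n`. This module PROVES it for the graded mirror table on `S♭` (`𝕊 = shiftSetFlat`,
`α = mirrorTable ε ε`, `0 ≤ ε`, `0 < ε₀`, `0 ≤ c₀`, `0 ≤ V`), following theory-1's route with FINITE partial tails:

* `QuadPolar.hasDerivWithinAt_Icc_of_pseudoFlowOnShift_exact` — an exact flow solves the lattice with derivatives
  WITHIN `[0, τ]` at every point of `[0, τ]`;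
* `fluxT_far_small` — the far flux `T_{j+L}` is uniformly small on `[0, τ]` for `L` large (format a-priori decay (4.5):
  `|T_k| ≤ (1+ε)M³(1+ε₀)^{−15k/2}`);
* `partialTail_hasDerivWithinAt` — the partial tail energy `E_L(s) = Σ_{j<m≤j+L} ½Σᵢ Sᵢ(m,s)²` has derivative
  `T_j − T_{j+L}` (telescoped `MirrorPulse.site_energy_flux`);
* `aheadCutStep` — the bootstrap (`Bootstrap.Icc_induction` on `2E_L`): a-priori `2E_L ≤ 4G²` on `[0, s]` gives
  `|a_{j+1}| ≤ 2G`, `|T_j| ≤ clock_j·V·2G·(V + 2εG)`, hence `2E_L(s) ≤ G² + 4c₀·clock_j·V·G(V + 2εG) + 2c₀η_L < 4G²`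
  with the far-flux slack `η_L` chosen inside the strict closing margin; so `|Sᵢ(m,t)| ≤ √(2E_L(t)) ≤ 2G`.

HONEST FRAMING: an a-priori estimate for MODEL-lattice certificate flows (Tao 2016 §4 vocabulary on `S♭`, graded mirror
table, `m = 2`); the boundary bond bound, the initial tail size and the closing inequality are HYPOTHESES (their sizes are
desk floats in theory-1's AHEAD-TAIL-62, unsealed); nothing certified; no item closed; nothing about the Navier–Stokes
equations.
-/

noncomputable section

-- the sub-problem namespace repeats the summit name by design (D-0017)
set_option linter.dupNamespace false

namespace Summit.NavierStokesRegularity.NavierStokesRegularity.Theorems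

open Set Finset Literature.Analysis.FluidPDE Literature.Analysis.FluidPDE.TaoCascade MirrorPulse

namespace QuadPolar

variable {m : ℕ}

/-- **An exact (`κ₁ = 0`) `PseudoFlowOnShift` flow solves the lattice with derivatives WITHIN `[0, τ]` at every point of
`[0, τ]`** (endpoints included, one-sided there). [cite: Tao2016AveragedNS, §4 Lemma 4.1 (4.8); cell vocabulary, shift-set parametrised] -/
theorem hasDerivWithinAt_Icc_of_pseudoFlowOnShift_exact {𝕊 : Finset (ℤ × ℤ × ℤ)} {τ ε₀ : ℝ}
    {α : Fin m → Fin m → Fin m → ℤ × ℤ × ℤ → ℝ} {κ₂ : ℝ} {S₀ F₀ B₀ : Fin m → ℤ → ℝ}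
    {S F : Fin m → ℤ → ℝ → ℝ} (h : PseudoFlowOnShift 𝕊 τ ε₀ α 0 κ₂ S₀ F₀ B₀ S F) (i : Fin m) (k : ℤ) {s : ℝ}
    (hs : s ∈ Icc 0 τ) : HasDerivWithinAt (S i k) (quadTermOn 𝕊 ε₀ α S i k s) (Icc 0 τ) s := by
  have hmot := h.motion i k s hs
  rw [zero_mul, zero_mul] at hmot
  have heq : derivWithin (S i k) (Icc 0 τ) s = quadTermOn 𝕊 ε₀ α S i k s := by
    have := abs_nonpos_iff.mp hmot
    linarith
  have hdiff : DifferentiableWithinAt ℝ (S i k) (Icc 0 τ) s :=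
    (h.contDiffOn_S i k).differentiableOn (by norm_num) s hs
  rw [← heq]
  exact hdiff.hasDerivWithinAt

end QuadPolar

namespace HopTube

section Flow

variable {ε ε₀ τ κ₁ κ₂ : ℝ} {S₀ F₀ B₀ : Fin 2 → ℤ → ℝ} {S F : Fin 2 → ℤ → ℝ → ℝ}

/-- **Far flux decay from the format a-priori clause (4.5).** If `(1 + (1+ε₀)^{10k})·|Sᵢ(k,s)| ≤ M` for all sites at time
`s` (`0 ≤ ε`, `0 < ε₀`), then `|T_k(s)| ≤ (1+ε)·M³·(1+ε₀)^{−15k/2}` for every shell `k`.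
[cite: Tao2016AveragedNS, §4 Lemma 4.1 (4.5), (4.3) (statement shape); cell LADDER §62 (AHEAD-TAIL-62, far flux)] -/
theorem abs_fluxT_le_far (hε : 0 ≤ ε) (hε₀ : 0 < ε₀) {M s : ℝ}
    (hM : ∀ (i : Fin 2) (k : ℤ), (1 + (1 + ε₀) ^ ((10 : ℝ) * k)) * |S i k s| ≤ M) (k : ℤ) :
    |fluxT ε ε₀ S k s| ≤ (1 + ε) * M ^ 3 * (1 + ε₀) ^ ((-15 / 2 : ℝ) * k) := by
  have h1 : (0 : ℝ) < 1 + ε₀ := by linarith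
  have hpow0 : ∀ x : ℝ, 0 < (1 + ε₀) ^ x := fun x => Real.rpow_pos_of_pos h1 x
  have hM0 : 0 ≤ M := le_trans (mul_nonneg (by positivity) (abs_nonneg _)) (hM 0 0)
  -- plain bounds `|S| ≤ M`
  have hA : ∀ (i : Fin 2) (k : ℤ), |S i k s| ≤ M := by
    intro i k
    have h := hM i k
    have hp : (1 : ℝ) ≤ 1 + (1 + ε₀) ^ ((10 : ℝ) * k) := by linarith [hpow0 ((10 : ℝ) * k)]
    calc |S i k s| = 1 * |S i k s| := (one_mul _).symm
      _ ≤ (1 + (1 + ε₀) ^ ((10 : ℝ) * k)) * |S i k s| := mul_le_mul_of_nonneg_right hp (abs_nonneg _)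
      _ ≤ M := h
  -- weighted bound `(1+ε₀)^{10k}|S| ≤ M`
  have hB : ∀ (i : Fin 2) (k : ℤ), (1 + ε₀) ^ ((10 : ℝ) * k) * |S i k s| ≤ M := by
    intro i k
    have h := hM i k
    have : (1 + ε₀) ^ ((10 : ℝ) * k) * |S i k s| ≤ (1 + (1 + ε₀) ^ ((10 : ℝ) * k)) * |S i k s| :=
      mul_le_mul_of_nonneg_right (by linarith) (abs_nonneg _)
    exact this.trans h
  -- the clock splits as `(1+ε₀)^{−15k/2} · (1+ε₀)^{10k}`
  have hclock : clock ε₀ k = (1 + ε₀) ^ ((-15 / 2 : ℝ) * k) * (1 + ε₀) ^ ((10 : ℝ) * k) := by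
    unfold clock
    rw [← Real.rpow_add h1]
    congr 1; ring
  have hck : 0 ≤ clock ε₀ k := clock_nonneg (by linarith) k
  -- assemble
  unfold fluxT
  rw [abs_mul, abs_mul, abs_mul, abs_of_nonneg hck]
  have hv : clock ε₀ k * |S 1 k s| ≤ (1 + ε₀) ^ ((-15 / 2 : ℝ) * k) * M := by
    rw [hclock, mul_assoc]
    exact mul_le_mul_of_nonneg_left (hB 1 k) (hpow0 _).le
  have ha : |S 0 (k + 1) s| ≤ M := hA 0 (k + 1)
  have hlast : |S 1 k s + ε * S 0 (k + 1) s| ≤ M + ε * M := by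
    calc |S 1 k s + ε * S 0 (k + 1) s| ≤ |S 1 k s| + |ε * S 0 (k + 1) s| := abs_add_le _ _
      _ = |S 1 k s| + ε * |S 0 (k + 1) s| := by rw [abs_mul, abs_of_nonneg hε]
      _ ≤ M + ε * M := add_le_add (hA 1 k) (mul_le_mul_of_nonneg_left ha hε)
  have hw0 : 0 ≤ (1 + ε₀) ^ ((-15 / 2 : ℝ) * k) * M := mul_nonneg (hpow0 _).le hM0
  calc clock ε₀ k * |S 1 k s| * |S 0 (k + 1) s| * |S 1 k s + ε * S 0 (k + 1) s|
      = (clock ε₀ k * |S 1 k s|) * (|S 0 (k + 1) s| * |S 1 k s + ε * S 0 (k + 1) s|) := by ring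
    _ ≤ ((1 + ε₀) ^ ((-15 / 2 : ℝ) * k) * M) * (M * (M + ε * M)) :=
        mul_le_mul hv (mul_le_mul ha hlast (abs_nonneg _) hM0) (by positivity) hw0
    _ = (1 + ε) * M ^ 3 * (1 + ε₀) ^ ((-15 / 2 : ℝ) * k) := by ring

/-- **The far flux is uniformly small.** Along a `PseudoFlowOnShift` flow of the graded mirror table (`0 ≤ ε`, `0 < ε₀`) the
energy flux through the cut at shell `j + L` is at most `η` on `[0, τ]` for all large `L`.
[cite: Tao2016AveragedNS, §4 Lemma 4.1 (4.5), (4.3) (statement shape); cell LADDER §62 (AHEAD-TAIL-62, far flux)] -/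
theorem fluxT_far_small (h : PseudoFlowOnShift shiftSetFlat τ ε₀ (mirrorTable ε ε) κ₁ κ₂ S₀ F₀ B₀ S F)
    (hε : 0 ≤ ε) (hε₀ : 0 < ε₀) (j : ℤ) {η : ℝ} (hη : 0 < η) :
    ∃ L₀ : ℕ, ∀ L : ℕ, L₀ ≤ L → ∀ s ∈ Icc 0 τ, |fluxT ε ε₀ S (j + L) s| ≤ η := by
  obtain ⟨M, hM⟩ := h.apriori_S
  have h1 : (0 : ℝ) < 1 + ε₀ := by linarith
  set ρ : ℝ := (1 + ε₀) ^ (-15 / 2 : ℝ) with hρ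
  have hρ0 : 0 < ρ := Real.rpow_pos_of_pos h1 _
  have hρ1 : ρ < 1 := Real.rpow_lt_one_of_one_lt_of_neg (by linarith) (by norm_num)
  set C : ℝ := (1 + ε) * |M| ^ 3 * (1 + ε₀) ^ ((-15 / 2 : ℝ) * j) with hC
  have hC0 : 0 ≤ C := by positivity
  -- geometric smallness
  obtain ⟨L₀, hL₀⟩ := exists_pow_lt_of_lt_one (show 0 < η / (C + 1) by positivity) hρ1
  refine ⟨L₀, fun L hL s hs => ?_⟩
  have hM0 : 0 ≤ M := le_trans (mul_nonneg (by positivity) (abs_nonneg _)) (hM s hs 0 0)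
  have hT := abs_fluxT_le_far (S := S) hε hε₀ (hM s hs) (j + L)
  -- `(1+ε₀)^{−15(j+L)/2} = (1+ε₀)^{−15j/2} · ρ^L`
  have hsplit : (1 + ε₀) ^ ((-15 / 2 : ℝ) * ((j + L : ℤ) : ℝ)) = (1 + ε₀) ^ ((-15 / 2 : ℝ) * j) * ρ ^ L := by
    rw [hρ, ← Real.rpow_natCast ((1 + ε₀) ^ (-15 / 2 : ℝ)) L, ← Real.rpow_mul h1.le, ← Real.rpow_add h1]
    congr 1; push_cast; ring
  have habsM : M = |M| := (abs_of_nonneg hM0).symm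
  have hρL : ρ ^ L ≤ ρ ^ L₀ := pow_le_pow_of_le_one hρ0.le hρ1.le hL
  calc |fluxT ε ε₀ S (j + L) s| ≤ (1 + ε) * M ^ 3 * (1 + ε₀) ^ ((-15 / 2 : ℝ) * ((j + L : ℤ) : ℝ)) := hT
    _ = C * ρ ^ L := by rw [hsplit, hC, habsM, abs_abs]; ring
    _ ≤ C * ρ ^ L₀ := mul_le_mul_of_nonneg_left hρL hC0
    _ ≤ (C + 1) * ρ ^ L₀ := mul_le_mul_of_nonneg_right (by linarith) (pow_nonneg hρ0.le _)
    _ ≤ (C + 1) * (η / (C + 1)) := mul_le_mul_of_nonneg_left hL₀.le (by positivity)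
    _ = η := by field_simp

end Flow

section Cut

variable {ε ε₀ τ κ₂ : ℝ} {S₀ F₀ B₀ : Fin 2 → ℤ → ℝ} {S F : Fin 2 → ℤ → ℝ → ℝ}

/-- **The partial tail energy is differentiated by the boundary fluxes** (telescoped `MirrorPulse.site_energy_flux`):
`d/ds Σ_{ℓ<L} ½Σᵢ Sᵢ(j+1+ℓ, s)² = T_j(s) − T_{j+L}(s)` within `[0, τ]`, along an exact graded mirror flow.
[cite: Tao2016AveragedNS, §4 (4.3) (local energy conservation); cell LADDER §62 (AHEAD-TAIL-62, tail energy)] -/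
theorem partialTail_hasDerivWithinAt (h : PseudoFlowOnShift shiftSetFlat τ ε₀ (mirrorTable ε ε) 0 κ₂ S₀ F₀ B₀ S F)
    (j : ℤ) (L : ℕ) {s : ℝ} (hs : s ∈ Icc 0 τ) :
    HasDerivWithinAt (fun x => ∑ l ∈ Finset.range L, (S 0 (j + 1 + l) x ^ 2 + S 1 (j + 1 + l) x ^ 2) / 2)
      (fluxT ε ε₀ S j s - fluxT ε ε₀ S (j + L) s) (Icc 0 τ) s := by
  have hd : ∀ l ∈ Finset.range L, HasDerivWithinAt (fun x => (S 0 (j + 1 + l) x ^ 2 + S 1 (j + 1 + l) x ^ 2) / 2)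
      (fluxT ε ε₀ S (j + l) s - fluxT ε ε₀ S (j + 1 + l) s) (Icc 0 τ) s := by
    intro l _
    have h0 := QuadPolar.hasDerivWithinAt_Icc_of_pseudoFlowOnShift_exact h 0 (j + 1 + l) hs
    have h1 := QuadPolar.hasDerivWithinAt_Icc_of_pseudoFlowOnShift_exact h 1 (j + 1 + l) hs
    have hsum := ((h0.mul h0).add (h1.mul h1)).div_const 2
    have key := site_energy_flux ε ε₀ S (j + 1 + l) s
    have e1 : j + 1 + (l : ℤ) - 1 = j + l := by ring
    rw [e1] at key
    have e2 : (fun x => (S 0 (j + 1 + l) x ^ 2 + S 1 (j + 1 + l) x ^ 2) / 2)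
        = fun x => (S 0 (j + 1 + l) x * S 0 (j + 1 + l) x + S 1 (j + 1 + l) x * S 1 (j + 1 + l) x) / 2 := by
      funext x; ring
    rw [e2]
    refine hsum.congr_deriv ?_
    rw [← key]; ring
  have hS := HasDerivWithinAt.fun_sum hd
  refine hS.congr_deriv ?_
  -- telescope `Σ_{ℓ<L} (T_{j+ℓ} − T_{j+1+ℓ}) = T_j − T_{j+L}`
  have htel := Finset.sum_range_sub' (fun l : ℕ => fluxT ε ε₀ S (j + l) s) L
  simp only [Nat.cast_zero, add_zero] at htel
  rw [← htel]
  refine Finset.sum_congr rfl fun l _ => ?_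
  have e3 : j + 1 + (l : ℤ) = j + ((l + 1 : ℕ) : ℤ) := by push_cast; ring
  rw [e3]

/-- one term of the partial tail energy is below the whole (nonnegative summands).
[folklore (finite sums of squares); cell LADDER §62] -/
theorem sq_le_two_mul_partialTail (S : Fin 2 → ℤ → ℝ → ℝ) (j : ℤ) {L l : ℕ} (hl : l < L) (i : Fin 2) (x : ℝ) :
    S i (j + 1 + l) x ^ 2 ≤ 2 * ∑ l' ∈ Finset.range L, (S 0 (j + 1 + l') x ^ 2 + S 1 (j + 1 + l') x ^ 2) / 2 := by
  have hmem : l ∈ Finset.range L := Finset.mem_range.mpr hl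
  have hone : (S 0 (j + 1 + l) x ^ 2 + S 1 (j + 1 + l) x ^ 2) / 2
      ≤ ∑ l' ∈ Finset.range L, (S 0 (j + 1 + l') x ^ 2 + S 1 (j + 1 + l') x ^ 2) / 2 :=
    Finset.single_le_sum (f := fun l' : ℕ => (S 0 (j + 1 + l') x ^ 2 + S 1 (j + 1 + l') x ^ 2) / 2)
      (fun l' _ => by positivity) hmem
  have hi : S i (j + 1 + l) x ^ 2 ≤ S 0 (j + 1 + l) x ^ 2 + S 1 (j + 1 + l) x ^ 2 := by
    fin_cases i
    · simp only [Fin.zero_eta, Fin.isValue]; nlinarith [sq_nonneg (S 1 (j + 1 + l) x)]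
    · simp only [Fin.mk_one, Fin.isValue]; nlinarith [sq_nonneg (S 0 (j + 1 + l) x)]
  linarith

end Cut

section Step

variable {ε ε₀ : ℝ} {P : TubeSchedule} {Bcl : ℕ → (Fin 2 → ℤ → ℝ) → Prop} {i₀ : Fin 2} {X₀ : Fin 2 → ℝ} {w : ℤ → ℝ}
  {r c₀ : ℝ} {ζ : ℕ → Fin 2 → ℤ → ℝ} {ustar : Fin 2 → ℤ → ℝ}

set_option maxHeartbeats 400000 in
/-- **THE PER-CUT STEP, PROVED** (theory-1 numT62 62.13 `AheadCutStepTarget`, graded mirror table on `S♭`, `0 ≤ ε`,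
`0 < ε₀`, `0 ≤ c₀`, `0 ≤ V`, `0 ≤ G`): boundary bond bound + initial tail energy + closing inequality ⇒ cut envelope `2G`.
See the module docstring for the tail-energy induction.
[cite: Tao2016AveragedNS, §4 (4.3), Lemma 4.1 (4.5), §5 (continuity argument), §6.2 Prop. 6.3 (ix) (statement shape); cell LADDER §62 (AHEAD-TAIL-62), referee A-115 (ii)] -/
theorem aheadCutStep (hε : 0 ≤ ε) (hε₀ : 0 < ε₀) (hc₀ : 0 ≤ c₀) {n : ℕ} {j : ℤ} {V G : ℝ} (hV : 0 ≤ V)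
    (hG : 0 ≤ G) :
    AheadCutStepTarget P Bcl shiftSetFlat ε₀ i₀ (mirrorTable ε ε) X₀ w r c₀ ζ ustar ε n j V G := by
  intro hVb hinit hclose z S₀ τ S F hprem t ht i m hm
  have hVb' := hVb z S₀ τ S F hprem
  have hinit' := hinit z S₀ τ S F hprem
  obtain ⟨-, -, hc₀τ, hflow⟩ := hprem
  have hε₀' : (-1 : ℝ) ≤ ε₀ := by linarith
  have hcj : 0 ≤ clock ε₀ j := clock_nonneg hε₀' j
  -- the flux bound at the cut and the strict margin
  set D₁ : ℝ := clock ε₀ j * V * (2 * G) * (V + ε * (2 * G)) with hD₁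
  have hD₁0 : 0 ≤ D₁ := by positivity
  have hmargin : G ^ 2 + 2 * c₀ * D₁ < 4 * G ^ 2 := by
    have hGpos : 0 < G := by
      rcases eq_or_lt_of_le hG with h0 | hpos
      · exfalso
        rw [← h0] at hclose
        have : 0 ≤ 4 / 3 * c₀ * clock ε₀ j * V * (V + 2 * ε * 0) := by positivity
        linarith
      · exact hpos
    have h3 := mul_lt_mul_of_pos_right hclose (by positivity : (0 : ℝ) < 3 * G)
    have e : 4 / 3 * c₀ * clock ε₀ j * V * (V + 2 * ε * G) * (3 * G) = 2 * c₀ * D₁ := by rw [hD₁]; ring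
    nlinarith [h3, e]
  -- the far-flux slack
  set η : ℝ := (4 * G ^ 2 - (G ^ 2 + 2 * c₀ * D₁)) / (2 * (c₀ + 1)) with hη
  have hη0 : 0 < η := by rw [hη]; exact div_pos (by linarith) (by positivity)
  have hb : G ^ 2 + 2 * c₀ * (D₁ + η) < 4 * G ^ 2 := by
    have hc1 : 2 * c₀ * η ≤ c₀ / (c₀ + 1) * (4 * G ^ 2 - (G ^ 2 + 2 * c₀ * D₁)) := by
      rw [hη]; apply le_of_eq; field_simp
    have hc2 : c₀ / (c₀ + 1) < 1 := by rw [div_lt_one (by positivity)]; linarith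
    have hpos : 0 < 4 * G ^ 2 - (G ^ 2 + 2 * c₀ * D₁) := by linarith
    have hc3 : c₀ / (c₀ + 1) * (4 * G ^ 2 - (G ^ 2 + 2 * c₀ * D₁)) < 1 * (4 * G ^ 2 - (G ^ 2 + 2 * c₀ * D₁)) :=
      mul_lt_mul_of_pos_right hc2 hpos
    nlinarith [hc1, hc3]
  -- the number of shells: far flux below `η`, and the shell `m` inside
  obtain ⟨L₀, hL₀⟩ := fluxT_far_small hflow hε hε₀ j hη0
  set L : ℕ := max L₀ (m - j).toNat with hL
  have hLL₀ : L₀ ≤ L := le_max_left _ _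
  have hmL : (m - j).toNat ≤ L := le_max_right _ _
  have hmj : ((m - j).toNat : ℤ) = m - j := Int.toNat_of_nonneg (by omega)
  have hL1 : 1 ≤ L := by
    have : 1 ≤ (m - j).toNat := by omega
    exact this.trans hmL
  -- the partial tail energy and its size
  set E : ℝ → ℝ := fun x => ∑ l ∈ Finset.range L, (S 0 (j + 1 + l) x ^ 2 + S 1 (j + 1 + l) x ^ 2) / 2 with hE
  have hsub : Icc 0 c₀ ⊆ Icc 0 τ := Icc_subset_Icc le_rfl hc₀τ
  have hEcont : ContinuousOn (fun x => 2 * E x) (Icc 0 c₀) := by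
    refine ContinuousOn.mul continuousOn_const ?_
    refine continuousOn_finsetSum _ fun l _ => ?_
    have h0 := (QuadPolar.continuousOn_of_pseudoFlowOnShift hflow 0 (j + 1 + l)).mono hsub
    have h1 := (QuadPolar.continuousOn_of_pseudoFlowOnShift hflow 1 (j + 1 + l)).mono hsub
    exact ((h0.pow 2).add (h1.pow 2)).div_const 2
  have hE0 : 2 * E 0 ≤ G ^ 2 := by
    have hinj : Set.InjOn (fun l : ℕ => j + 1 + (l : ℤ)) ↑(Finset.range L) := by
      intro a _ b _ hab; simpa using hab
    have hN := hinit' ((Finset.range L).image fun l : ℕ => j + 1 + (l : ℤ)) (by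
      intro m' hm'
      obtain ⟨l, -, rfl⟩ := Finset.mem_image.mp hm'
      omega)
    rw [Finset.sum_image hinj] at hN
    have e : 2 * E 0 = ∑ l ∈ Finset.range L, ∑ i : Fin 2, S₀ i (j + 1 + l) ^ 2 := by
      rw [hE]; dsimp only
      rw [Finset.mul_sum]
      refine Finset.sum_congr rfl fun l _ => ?_
      rw [Fin.sum_univ_two, hflow.init_S 0, hflow.init_S 1]; ring
    rw [e]; exact hN
  -- derivative of `E` within `[0, c₀]`
  have hEder : ∀ x ∈ Icc 0 c₀, HasDerivWithinAt E (fluxT ε ε₀ S j x - fluxT ε ε₀ S (j + L) x) (Icc 0 c₀) x :=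
    fun x hx => (partialTail_hasDerivWithinAt hflow j L (hsub hx)).mono hsub
  -- the bootstrap on `2E`
  have key := Bootstrap.Icc_induction (f := fun x => 2 * E x) (T := c₀) (a := 4 * G ^ 2)
    (b := G ^ 2 + 2 * c₀ * (D₁ + η)) hc₀ hEcont hb (hE0.trans (by nlinarith [hD₁0, hη0.le, hc₀])) ?_
  · -- conclusion: the shell `m` is the term `l₀ = m − j − 1 < L`
    have hft := key t ht
    set l₀ : ℕ := (m - j - 1).toNat with hl₀
    have hl₀j : j + 1 + (l₀ : ℤ) = m := by rw [hl₀, Int.toNat_of_nonneg (by omega)]; ring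
    have hl₀L : l₀ < L := by
      have : (l₀ : ℤ) < ((m - j).toNat : ℤ) := by rw [hmj, hl₀, Int.toNat_of_nonneg (by omega)]; omega
      omega
    have hsq : S i m t ^ 2 ≤ 2 * E t := by
      have := sq_le_two_mul_partialTail S j hl₀L i t
      rwa [hl₀j] at this
    have hsq' : S i m t ^ 2 ≤ (2 * G) ^ 2 := by nlinarith [hsq, hft, hb]
    exact abs_le_of_sq_le_sq' hsq' (by positivity) |> fun h => abs_le.mpr h
  -- THE STEP
  intro t₁ ht₁ hpast
  have ht₁c : t₁ ≤ c₀ := ht₁.2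
  -- the carrier just beyond the cut on `[0, t₁]`
  have ha : ∀ x ∈ Icc 0 t₁, |S 0 (j + 1) x| ≤ 2 * G := by
    intro x hx
    have hfx := hpast x hx
    have h0L : (0 : ℕ) < L := hL1
    have hsq := sq_le_two_mul_partialTail S j h0L 0 x
    simp only [Nat.cast_zero, add_zero] at hsq
    have hsq' : S 0 (j + 1) x ^ 2 ≤ (2 * G) ^ 2 := by nlinarith [hsq, hfx]
    exact abs_le.mpr (abs_le_of_sq_le_sq' hsq' (by positivity))
  -- the derivative bound on `[0, t₁)`
  have hbound : ∀ x ∈ Ico 0 t₁, ‖fluxT ε ε₀ S j x - fluxT ε ε₀ S (j + L) x‖ ≤ D₁ + η := by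
    intro x hx
    have hxc : x ∈ Icc 0 c₀ := ⟨hx.1, hx.2.le.trans ht₁c⟩
    have hfar := hL₀ L hLL₀ x (hsub hxc)
    have hv : |S 1 j x| ≤ V := hVb' x hxc
    have hax : |S 0 (j + 1) x| ≤ 2 * G := ha x ⟨hx.1, hx.2.le⟩
    have hTj : |fluxT ε ε₀ S j x| ≤ D₁ := by
      unfold fluxT
      rw [abs_mul, abs_mul, abs_mul, abs_of_nonneg hcj]
      have h3 : |S 1 j x + ε * S 0 (j + 1) x| ≤ V + ε * (2 * G) := by
        calc |S 1 j x + ε * S 0 (j + 1) x| ≤ |S 1 j x| + |ε * S 0 (j + 1) x| := abs_add_le _ _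
          _ = |S 1 j x| + ε * |S 0 (j + 1) x| := by rw [abs_mul, abs_of_nonneg hε]
          _ ≤ V + ε * (2 * G) := add_le_add hv (mul_le_mul_of_nonneg_left hax hε)
      rw [hD₁]
      have h12 : |S 1 j x| * |S 0 (j + 1) x| ≤ V * (2 * G) := mul_le_mul hv hax (abs_nonneg _) hV
      calc clock ε₀ j * |S 1 j x| * |S 0 (j + 1) x| * |S 1 j x + ε * S 0 (j + 1) x|
          = clock ε₀ j * ((|S 1 j x| * |S 0 (j + 1) x|) * |S 1 j x + ε * S 0 (j + 1) x|) := by ring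
        _ ≤ clock ε₀ j * ((V * (2 * G)) * (V + ε * (2 * G))) :=
            mul_le_mul_of_nonneg_left (mul_le_mul h12 h3 (abs_nonneg _) (by positivity)) hcj
        _ = clock ε₀ j * V * (2 * G) * (V + ε * (2 * G)) := by ring
    rw [Real.norm_eq_abs]
    calc |fluxT ε ε₀ S j x - fluxT ε ε₀ S (j + L) x| ≤ |fluxT ε ε₀ S j x| + |fluxT ε ε₀ S (j + L) x| := abs_sub _ _
      _ ≤ D₁ + η := add_le_add hTj hfar
  -- integrate on `[0, t₁]`
  have hsub₁ : Icc 0 t₁ ⊆ Icc 0 c₀ := Icc_subset_Icc le_rfl ht₁c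
  have hmvt := norm_image_sub_le_of_norm_deriv_le_segment' (fun x hx => (hEder x (hsub₁ hx)).mono hsub₁) hbound
    t₁ (right_mem_Icc.mpr ht₁.1)
  rw [Real.norm_eq_abs, sub_zero] at hmvt
  have hEt : E t₁ ≤ E 0 + (D₁ + η) * t₁ := by
    have := (abs_le.mp hmvt).2; linarith
  have hDt : (D₁ + η) * t₁ ≤ (D₁ + η) * c₀ := mul_le_mul_of_nonneg_left ht₁c (by positivity)
  show 2 * E t₁ ≤ G ^ 2 + 2 * c₀ * (D₁ + η)
  nlinarith [hEt, hDt, hE0]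

end Step

end HopTube

end Summit.NavierStokesRegularity.NavierStokesRegularity.Theorems

end
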